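import Summits.CriticalPhenomena.PercolationContinuityZ3.Theorems.Transplant.SkelNegBParamsKitS
import HarnessLib

/-!
# N1 (the `{±1}` node), (R) column ((R6c) shared block; NEG-SCOPE B.17): THE APRON KITS' LEVEL BOXES AND REACH, ONCE — for the apron kit of record
# `KS.apron Φ t D mk A r₀` (any `A, r₀`): the three level-box widenings on ANY box `[lo, hi]` at every level `j ≥ j₀A` (`levels_wide`), and the reach inequality
# `j₁A + (N·(T₀+1) + N·d + KCmax) ≤ RA′` (`j_reach_le`, `N = 13`) — the forms `rootOblTWAt_of_numbers6_x/_y` ask per schedule box; factored out of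
# `rootOblTWAt_negBS3_x` so that the three-leg `rootOblTWAt_negBS4_y` fits the 400-line file limit.

builds on p205010 (kernel theorem, internal audit signed; external expert review pending) — nothing in this file uses p205010; nothing here is a claim about the open node.
Lane `prim-bschramm`, seat `prim-bschramm-p3` (gen 10; design owner + (R) owner); helper file (`--supports stmt-CriticalPhenomena-4575 --as helper`).
[cite: KozmaNitzan2024, §4 Lemma 10 Steps II–III (pp. 18–21)]
-/

noncomputable section

open scoped Classical

namespace Summit.CriticalPhenomena.PercolationContinuityZ3.Theorems.Transplant

namespace PlanarSkeletonNeg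

namespace NegB

open Literature.Probability.Percolation Literature.Probability.LatticeModels SimpleGraph
open SkelConc (Consts)
open SkelI (tanOff)
open Skelφ.StepI (DataN)

section Kit

variable (κ : Consts) {V : Type} [Countable V] {G : SimpleGraph V} [G.LocallyFinite] (Φ : PlanarSkeletonNeg G) (t : V) (p : unitInterval) (D : DataN V) (mk : ℕ)

omit [Countable V] in
/-- **The three level-box widenings of the apron kit on any box** `[lo, hi]` (`lo ≤ hi`) at a level `j ≥ j₀A`: tangential offset, depth `d + 2`, and the
`shellD + 1 + d + KCmax + Rs` width (all `≤ 2j` by `levels_wide`). [cite: KozmaNitzan2024, §4 Lemma 10 Step II (p. 18)] -/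
theorem rootKit_levels (A : ℤ) (r₀ : ℕ) {lo hi : Site 2} (hlohi : lo ≤ hi) {j : ℕ} (hj : KS.j₀A t D mk ≤ j) :
    (∀ i, (lo - (j : Site 2)) i + 2 * tanOff (KS.apron Φ t D mk A r₀).ℓs (KS.apron Φ t D mk A r₀).M ≤ (hi + (j : Site 2)) i) ∧
    (∀ i, (lo - (j : Site 2)) i + ((KS.apron Φ t D mk A r₀).d + 2 : ℕ) ≤ (hi + (j : Site 2)) i) ∧
    (∀ i, (lo - (j : Site 2)) i + ((Skelφ.shellD (KS.apron Φ t D mk A r₀) + 1 + (KS.apron Φ t D mk A r₀).d + KS.KCmax t D mk + KS.Rs t D mk : ℕ) : ℤ) ≤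
      (hi + (j : Site 2)) i) := by
  have hwin : ∀ (X : ℤ), X ≤ 2 * (j : ℤ) → ∀ i : Fin 2, (lo - (j : Site 2)) i + X ≤ (hi + (j : Site 2)) i := by
    intro X hX i
    have h := hlohi i
    simp only [Pi.sub_apply, Pi.add_apply, Pi.natCast_apply]
    linarith
  have hLW := KS.levels_wide t D mk hj
  have hT₀ := KS.tanOff_apron Φ t D mk A r₀
  have hDsh := KS.shellD_apron Φ t D mk A r₀
  have hd : (KS.apron Φ t D mk A r₀).d = KS.da t D mk := rfl
  refine ⟨hwin _ ?_, hwin _ ?_, hwin _ ?_⟩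
  · rw [hT₀]; exact_mod_cast hLW.1
  · rw [hd]; exact_mod_cast hLW.2.1
  · rw [hDsh, hd]; exact_mod_cast hLW.2.2

/-- **The apron kit's reach fits the level radius**: `j₁A + (N·(T₀+1) + N·d + KCmax) ≤ RA′` (`N = 13`, `j_reach_le`). [cite: KozmaNitzan2024, §4 Lemma 10 (p. 21)] -/
theorem rootKit_reach (A : ℤ) (r₀ : ℕ) :
    KS.j₁A κ Φ t p D mk + ((KS.apron Φ t D mk A r₀).N * (tanOff (KS.apron Φ t D mk A r₀).ℓs (KS.apron Φ t D mk A r₀).M + 1) +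
      (KS.apron Φ t D mk A r₀).N * (KS.apron Φ t D mk A r₀).d + KS.KCmax t D mk) ≤ KS.RA' κ Φ t p D mk := by
  have h := KS.j_reach_le κ Φ t p D mk (le_refl (KS.j₁A κ Φ t p D mk))
  have hRA := (KS.RA'_eq κ Φ t p D mk).2.1
  rw [KS.tanOff_apron, show (KS.apron Φ t D mk A r₀).d = KS.da t D mk from rfl, show (KS.apron Φ t D mk A r₀).N = 13 from rfl]
  unfold KS.reachA at h
  omega

end Kit

end NegB

end PlanarSkeletonNeg

end Summit.CriticalPhenomena.PercolationContinuityZ3.Theorems.Transplant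

end
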